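import Summits.ResolutionOfSingularities.ResolutionOfSingularities.Theorems.HilbertSamuelEliminationSigmaMaxModificationsCorridor3SigmaHybridScope
import Summits.ResolutionOfSingularities.ResolutionOfSingularities.Theorems.HilbertSamuelEliminationSigmaMaxModificationsCorridor3SigmaIsoBoundaryRows
import Summits.ResolutionOfSingularities.ResolutionOfSingularities.Theorems.HilbertSamuelEliminationSigmaMaxModificationsCorridor3SigmaIsoBoundaryReaches
import Summits.ResolutionOfSingularities.ResolutionOfSingularities.Theorems.HilbertSamuelEliminationSigmaMaxModificationsCorridor3WMono
import Summits.ResolutionOfSingularities.ResolutionOfSingularities.Theorems.HilbertSamuelEliminationCampaignW42OracleLocal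
import HarnessLib

/-!
# [OURS · L1 W4.2] (E7) `stub_Wtop_elimination ⇐ HybridEliminationHyp3`: the origin-wise JOIN of the hybrid's rows into the E6 socket
# (cell res-hironaka, LADDER-RESOLUTION rung L; slot W4.2, crux chain w42 `SigmaMaxModificationsCorridor3` stmt-ResolutionOfSingularities-19249 /
# crux stmt-…-18506; res-L1-w42-plan-1 RULING v3.14-18 (FI) «E7 (pv-047): stub ⇐ `HybridEliminationHyp3` = ∃(π, ω) ⟨clauses⟩ ∧ Low ∧ Iso ∧ Top»;
# hand res-D-pv-047 AS res-L1-s46-pv-10; `--supports stmt-ResolutionOfSingularities-19249 --as helper`)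

HONEST FRAMING. OURS proof architecture; NOTHING below is a statement of H. Hironaka's manuscript [Hironaka2017] (candidate, under review) nor of
Cossart–Jannsen–Saito. The one printed fact that enters, CJS Thm. 3.10 (4) (Hironaka's `e_{x'} ≤ e_x` at near points of a permissible blow-up), enters as
the tree's NAMED FACT `CossartJannsenSaito2020_thm_3_10_4` taken as a HYPOTHESIS `h310` (the skeleton v8.3 `w_ladder_elim` holds it as
`stub_printedFactsL.2.2`); no new named fact is introduced. AI-written; AI review is weaker than expert review.

## What is here (namespace `…Theorems.SigmaMaxModificationsCorridor3.Sigma`)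

* §1 **σE-W-MONO modulo CJS Thm. 3.10 (4), σ-PARAMETRIC**: `geomDirDim_le_of_canonicalNearStepσE` — for ANY boundary-aware strategy `σ` admissible on its
  run-wise scope (`IsAdmissibleStrategyOnE (StrategyE.RunReachableState p σ N ν E₀) N ν σ`, p527149), along a σE-step from a stage of the marked scope
  `ē` does not increase: over the centre by CJS 3.10 (4) at the CLOSED near point (the run invariant `RunGood` of p529895 supplies excellence,
  `dim ≤ N`, and the permissibility of the centre comes from admissibility at the run-reachable state it is taken from), off the centre by GW 13.91 (3).
* §2 **THE ORIGIN-WISE JOIN** (σ-parametric, chain logic + W-mono): `not_exists_chainσE_of_rows` — from a stage `s₀`, the four rows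
  (Live) no eternally-waiting chain, (Low) no moving chain of constant grade `ē = e < N`, (Iso) no moving `ē ≥ N` chain isolated infinitely often,
  (Top) no moving `ē ≥ N` chain with no isolated stage, give «NO infinite σE-chain `c` with `c 0 = s₀` at all» — verbatim the hypothesis `hno` of the
  E6 socket (p528862/p529895). The join is: waiting-tail or moving (`Moving.eventually_not_or_io`); moving ⇒ `ē` eventually constant (W-mono,
  `eventually_const_of_succ_le`) ⇒ a constant-grade tail, low or W-top; W-top ⇒ res-type-012's recurrence split `noMovingNearChainFromσE_iff_recurrence`
  at `B = Iso N`. Packaged as `RowsAtσE σ N ν s₀` (the four conjuncts).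
* §3 **THE DEGENERATE VALUE `ν = Φ^{(N)}`**: `Φ^{(N)}` maximal ⇒ every point lies in the `Φ`-stratum (CJS Lemma 2.23, tree `Scheme.iterPSum_Phi_le_hsFun`)
  ⇒ `TameWild.NuMod Y N d Φ` by the EMPTY modification (`TameWild.nuMod_of_forall_mem_hsStratum`): the registered stub carries no `ν ≠ Φ^{(3)}`
  (although the skeleton's `nuMod_three` holds it as `hne`), so the typed statement is closed as is.
* §4 **`HybridEliminationHyp3 p`** — per datum `(Y, ν, y)` with `ν ≠ Φ^{(3)}`: ∃ a menu-disciplined functional policy `π`, a functional fallback oracle `ω`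
  and an ORIGIN-INDEPENDENT initial boundary `E₀` (scheme-side default `[]`) such that the fallback satisfies clause (a) and totality on the run-wise scope
  of the hybrid `π.hybrid (StrategyE.ofStageOracleE ω)` (verbatim the E6 socket's clauses) and the four rows hold at every closed `y' ∈ Y(ν)`; and the two
  theorems **`nuMod_of_hybridEliminationHyp3`** (`TameWild.NuMod Y 3 d ν`, `d ≥ dim Y`) and the STUB-SHAPED **`wtop_elimination_of_hybridEliminationHyp3`**
  — at the prime `p`, VERBATIM the body of the registered `stub_Wtop_elimination` of skeleton v8.3 `w_ladder_elim` 736b6f580a9dcd0c (its R-side hypothesis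
  is used only to produce a maximal origin).

Row owners plug GLOBAL rows (`WtopRecIsoMσE` / `WtopEvNonIsoMσE` / `MaxOriginNoMovingNearChainAtQσE … (ē = e)` with `E₀' := fun X _ => E₀ X`) into the
origin-wise conjuncts by specialisation: every closed point of `Y(ν)` is a maximal origin (`isMaximalOrigin_of_mem_hsStratum`).

## References (context)

* V. Cossart, U. Jannsen, S. Saito, LNM 2270 (2020), Thm. 3.10 (4), Lemma 2.23, Def. 6.14, Rem. 6.29 (1), p. 107. [CossartJannsenSaito2020]
* U. Görtz, T. Wedhorn, *Algebraic Geometry I* (2nd ed. 2020), Prop. 13.91 (3). [GortzWedhorn2020]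
-/

noncomputable section

set_option linter.dupNamespace false -- mandated namespace of this single-conjunct summit

open CategoryTheory AlgebraicGeometry TopologicalSpace Topology
open Summit.ResolutionOfSingularities.ResolutionOfSingularities.Theorems.CampaignW42
open Summit.ResolutionOfSingularities.ResolutionOfSingularities.Theorems.SigmaMaxModificationsCorridor3.Moving
open Literature.AlgebraicGeometry.Resolution Literature.RingTheory.HilbertSamuel
open Literature.AlgebraicGeometry.CossartJannsenSaito2020

namespace Summit.ResolutionOfSingularities.ResolutionOfSingularities.Theorems.SigmaMaxModificationsCorridor3.Sigma

universe u

/-! ## §1. σE-W-mono modulo CJS Thm. 3.10 (4), for every strategy admissible on its run-wise scope -/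

section WMono

variable {p N : ℕ} {ν : ℕ → ℕ} {σ : StrategyE.{u}} {E₀ : ∀ (X : Scheme.{u}), X → Boundary X}

/-- At every stage of the marked scope of a strategy admissible on its run-wise scope the run invariant `RunGood` holds over the origin's ground field.
[cite: CossartJannsenSaito2020, Thm. 3.10 (1), Thm. 6.6] -/
theorem exists_runGood_of_inScopeMσE (hadm : IsAdmissibleStrategyOnE (StrategyE.RunReachableState p σ N ν E₀) N ν σ)
    {s : MarkedStageE.{u}} (hs : InScopeMσE p σ N ν E₀ s) : ∃ (k : Type u) (_ : Field k), RunGood k N ν s.W := by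
  obtain ⟨X, hX, x, hx, hreach⟩ := hs
  obtain ⟨k, hk, h0⟩ := RunGood.init hx
  have hperm : ∀ (W : Scheme.{u}) (hW : IsLocallyNoetherian W) (L : Labelling W) (P : Option (Pending W)) (E : Boundary W),
      StrategyE.RunReachableState p σ N ν E₀ W hW L P E →
        ∀ (C : W.IdealSheafData) (P' : Option (Pending (blowup C))), σ.step W hW N ν L P E C P' → IdealSheafData.IsPermissible C :=
    fun W hW L P E hS C P' hstep => ((hadm W hW L P E hS).1 C P' hstep).1
  exact ⟨k, hk, runGood_of_stateReachesσE (t := s.toStateσE) hx h0 hperm hreach.stateReachesσE⟩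

/-- **σE-W-MONO modulo CJS Thm. 3.10 (4), σ-PARAMETRIC**: for a boundary-aware strategy `σ` admissible on its run-wise scope, along a σE-step from a
stage of the marked scope the geometric directrix dimension of the marked point does not increase — over the centre CJS Thm. 3.10 (4) at the CLOSED near
point `x_{n+1}` (`H^N(x_{n+1}) = ν = H^N(x_n)`; excellence and `dim ≤ N` from `RunGood`, permissibility of the centre from admissibility), off the centre
the blow-up is a local isomorphism (GW Prop. 13.91 (3)). [cite: CossartJannsenSaito2020, Thm. 3.10 (4)] [cite: GortzWedhorn2020, Prop. 13.91 (3)] -/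
theorem geomDirDim_le_of_canonicalNearStepσE (h310 : CossartJannsenSaito2020_thm_3_10_4.{u})
    (hadm : IsAdmissibleStrategyOnE (StrategyE.RunReachableState p σ N ν E₀) N ν σ)
    {s s' : MarkedStageE.{u}} (hs : InScopeMσE p σ N ν E₀ s) (hst : CanonicalNearStepσE σ N ν s s') :
    s'.geomDirDim ≤ s.geomDirDim := by
  obtain ⟨k, hk, hgood⟩ := exists_runGood_of_inScopeMσE hadm hs
  have hmem : s.pt ∈ Scheme.hsStratum s.W N ν := by
    obtain ⟨X, hX, x, hx, hreach⟩ := hs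
    exact pt_mem_hsStratum_of_reachesσE hreach hx.mem_stratum
  have hscope : StrategyE.RunReachableState p σ N ν E₀ s.W s.ln s.L s.P s.E :=
    StrategyE.reachableState_subset_runReachableState (StrategyE.reachableState_of_inScopeMσE hs)
  obtain ⟨C, P', hln, x', hstep, hπ, hcl, hx'ν, rfl⟩ := hst
  haveI : IsLocallyNoetherian s.W := s.ln
  haveI : IsLocallyNoetherian (blowup C) := hln
  have hperm : IdealSheafData.IsPermissible C := ((hadm s.W s.ln s.L s.P s.E hscope).1 C P' hstep).1
  show Scheme.geomDirDim (blowup C) x' ≤ Scheme.geomDirDim s.W s.pt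
  by_cases hxC : s.pt ∈ (C.support : Set s.W)
  · -- over the centre: CJS Thm. 3.10 (4) at the closed near point `x'`
    have hnear : Scheme.hsFun (blowup C) N x' = Scheme.hsFun s.W N ((blowup.π C).base x') := by
      rw [Scheme.mem_hsStratum_iff.mp hx'ν, hπ]
      exact (Scheme.mem_hsStratum_iff.mp hmem).symm
    have hle := geomDirDim_le_of_hsFun_eq_of_isClosed h310 hgood.isExcellent hperm (blowup.isBlowup C) hgood.dim_le
      (x' := x') (hπ.symm ▸ hxC) hcl hnear
    rwa [hπ] at hle
  · -- off the centre: the blow-up is a local isomorphism at `x'`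
    rw [← hπ] at hxC ⊢
    exact (Helpers.geomDirDim_blowup_eq_of_notMem_support C x' hxC).le

end WMono

/-! ## §2. The four origin-wise rows and their join -/

section Join

variable {σ : StrategyE.{u}} {N : ℕ} {ν : ℕ → ℕ}

/-- [OURS · L1 W4.2] **THE FOUR ROWS AT A STAGE `s₀`** of a boundary-aware strategy `σ` at level `N`, value `ν`: **(Live)** no eternally-waiting σE-chain
from `s₀` (marked point never blown up); **(Low)** for every grade `e < N`, no MOVING σE-chain from `s₀` of constant grade `ē = e`; **(Iso)** no moving
σE-chain from `s₀` of grade `ē ≥ N` that is isolated in the Hilbert–Samuel locus infinitely often; **(Top)** no moving σE-chain from `s₀` of grade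
`ē ≥ N` none of whose stages is isolated. All four in the tree's row vocabulary (`NoWaitingChainFromσE`, `NoMovingNearChainFromσE`,
`NoMovingRecurrentNearChainFromσE`; tails allowed through `ReachesσE s₀ (c 0)`). OURS bookkeeping; NOT a statement of the manuscript. [folklore] -/
def RowsAtσE (σ : StrategyE.{u}) (N : ℕ) (ν : ℕ → ℕ) (s₀ : MarkedStageE.{u}) : Prop :=
  NoWaitingChainFromσE σ N ν s₀ ∧
    (∀ e, e < N → NoMovingNearChainFromσE σ N ν s₀ fun s => s.geomDirDim = e) ∧
    NoMovingRecurrentNearChainFromσE σ N ν s₀ (fun s => N ≤ s.geomDirDim) (fun s => Iso N s) ∧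
    NoMovingNearChainFromσE σ N ν s₀ fun s => N ≤ s.geomDirDim ∧ ¬ Iso N s

/-- Unfolding `RowsAtσE`. [folklore] -/
theorem rowsAtσE_iff (s₀ : MarkedStageE.{u}) :
    RowsAtσE σ N ν s₀ ↔
      NoWaitingChainFromσE σ N ν s₀ ∧
        (∀ e, e < N → NoMovingNearChainFromσE σ N ν s₀ fun s => s.geomDirDim = e) ∧
        NoMovingRecurrentNearChainFromσE σ N ν s₀ (fun s => N ≤ s.geomDirDim) (fun s => Iso N s) ∧
        NoMovingNearChainFromσE σ N ν s₀ fun s => N ≤ s.geomDirDim ∧ ¬ Iso N s :=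
  Iff.rfl

/-- **(Iso) ∧ (Top) ⇒ no moving W-top chain at all from `s₀`** (res-type-012's recurrence split at `B = Iso N`, read backwards). [folklore] -/
theorem noMovingNearChainFromσE_top_of_iso_top {s₀ : MarkedStageE.{u}}
    (hiso : NoMovingRecurrentNearChainFromσE σ N ν s₀ (fun s => N ≤ s.geomDirDim) fun s => Iso N s)
    (htop : NoMovingNearChainFromσE σ N ν s₀ fun s => N ≤ s.geomDirDim ∧ ¬ Iso N s) :
    NoMovingNearChainFromσE σ N ν s₀ fun s => N ≤ s.geomDirDim :=
  (noMovingNearChainFromσE_iff_recurrence (fun s => Iso N s)).2 ⟨htop, hiso⟩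

/-- **THE ORIGIN-WISE JOIN**: if `ē` does not increase along σE-steps from stages reached from `s₀` (W-mono), then the four rows at `s₀` exclude EVERY
infinite σE-chain `c` with `c 0 = s₀` — a chain is eventually waiting (its tail is a waiting chain from a stage reached from `s₀`) or moving; along a
moving chain `ē` is eventually constant, and the constant-grade tail is a moving chain of grade `e < N` (Low) or of grade `ē ≥ N` throughout
((Iso) ∧ (Top) through the recurrence split). Exactly the hypothesis `hno` of the E6 socket. [folklore] -/
theorem not_exists_chainσE_of_rows {s₀ : MarkedStageE.{u}}
    (hmono : ∀ s s' : MarkedStageE.{u}, ReachesσE σ N ν s₀ s → CanonicalNearStepσE σ N ν s s' → s'.geomDirDim ≤ s.geomDirDim)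
    (hrows : RowsAtσE σ N ν s₀) :
    ¬ ∃ c : ℕ → MarkedStageE.{u}, c 0 = s₀ ∧ ∀ n, CanonicalNearStepσE σ N ν (c n) (c (n + 1)) := by
  obtain ⟨hlive, hlow, hiso, htop⟩ := hrows
  rintro ⟨c, hc0, hstep⟩
  have h0 : ReachesσE σ N ν s₀ (c 0) := hc0 ▸ Relation.ReflTransGen.refl
  have hreach : ∀ n, ReachesσE σ N ν s₀ (c n) := reachesσE_chain h0 hstep
  rcases eventually_not_or_io (fun n => (c n).IsBlownUpσE σ N ν) with ⟨n₀, hn₀⟩ | hmov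
  · -- eventually waiting: the tail from `n₀` is a waiting chain from a stage reached from `s₀`
    exact hlive ⟨fun n => c (n₀ + n), hreach n₀, fun n => hstep (n₀ + n), fun n => hn₀ _ (Nat.le_add_right _ _)⟩
  · -- moving: `ē` is eventually constant along the chain
    have hg : ∀ n, (c (n + 1)).toMarkedStage.geomDirDim ≤ (c n).toMarkedStage.geomDirDim :=
      fun n => hmono _ _ (hreach n) (hstep n)
    obtain ⟨n₀, hn₀⟩ := eventually_const_of_succ_le (g := fun n => (c n).toMarkedStage.geomDirDim) hg
    by_cases hN : N ≤ (c n₀).toMarkedStage.geomDirDim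
    · -- a moving W-top tail
      refine noMovingNearChainFromσE_top_of_iso_top hiso htop
        ⟨fun n => c (n₀ + n), hreach n₀, fun n => hstep (n₀ + n), fun n => ?_, io_shift hmov n₀⟩
      show N ≤ (c (n₀ + n)).toMarkedStage.geomDirDim
      rw [hn₀ n]
      exact hN
    · -- a moving tail of constant low grade
      exact hlow _ (lt_of_not_ge hN)
        ⟨fun n => c (n₀ + n), hreach n₀, fun n => hstep (n₀ + n), fun n => hn₀ n, io_shift hmov n₀⟩

end Join

/-! ## §3. The degenerate value `ν = Φ^{(N)}`: the empty modification -/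

section Degenerate

/-- If `Φ^{(N)}` is a MAXIMAL value of `H^N_Y` then EVERY point of `Y` lies in the `Φ^{(N)}`-stratum (`Φ^{(N)} ≤ H^N_Y(y)` everywhere, CJS Lemma 2.23).
[cite: CossartJannsenSaito2020, Lemma 2.23] -/
theorem forall_mem_hsStratum_of_maximal_Phi {Y : Scheme.{u}} [IsLocallyNoetherian Y] {N : ℕ}
    (hmax : Maximal (· ∈ Scheme.hsValues Y N) (iterPSum N Phi)) (y : Y) : y ∈ Scheme.hsStratum Y N (iterPSum N Phi) := by
  rw [Scheme.mem_hsStratum_iff]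
  exact le_antisymm (hmax.2 ⟨y, rfl⟩ (Scheme.iterPSum_Phi_le_hsFun N y)) (Scheme.iterPSum_Phi_le_hsFun N y)

/-- An empty topological space has topological Krull dimension `⊥` (an irreducible closed subset is non-empty). [folklore] -/
theorem topologicalKrullDim_eq_bot_of_isEmpty (α : Type*) [TopologicalSpace α] [IsEmpty α] : topologicalKrullDim α = ⊥ := by
  haveI : IsEmpty (IrreducibleCloseds α) := ⟨fun Z => Z.isIrreducible.nonempty.elim fun a _ => isEmptyElim a⟩
  exact Order.krullDim_eq_bot

/-- **THE EMPTY MODIFICATION**: if EVERY point of the reduced scheme `Y` lies in the `ν`-stratum, the empty open subscheme `∅ ↪ Y` is a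
`ν`-modification `TameWild.NuMod Y N d ν` (proper, reduced, `dim ∅ = ⊥`, an isomorphism over every open inside `Y ∖ Y(ν) = ∅`, dense-pullback clause and
`H^N` clause vacuous, `ν` not a value of `Σ_∅`). Degenerate but exactly the typed predicate. [cite: CossartJannsenSaito2020, Def. 6.14] -/
theorem _root_.Summit.ResolutionOfSingularities.ResolutionOfSingularities.Theorems.SigmaMaxModificationsCorridor3.TameWild.nuMod_of_forall_mem_hsStratum
    {Y : Scheme.{0}} [IsReduced Y] {N d : ℕ} {ν : ℕ → ℕ} (hall : ∀ y : Y, y ∈ Scheme.hsStratum Y N ν) : TameWild.NuMod Y N d ν := by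
  haveI hE : IsEmpty ((⊥ : Y.Opens) : Scheme.{0}) := ⟨fun y => y.2⟩
  refine ⟨(⊥ : Y.Opens), (⊥ : Y.Opens).ι, inferInstance, inferInstance, ?_, ?_, ?_, ?_, ?_, ?_⟩
  · rw [topologicalKrullDim_eq_bot_of_isEmpty]
    exact bot_le
  · rw [topologicalKrullDim_eq_bot_of_isEmpty]
    exact bot_le
  · intro U hU
    haveI : IsEmpty (U : Scheme.{0}) := ⟨fun u => hU u.2 (hall u.1)⟩
    exact isIso_of_isEmpty _
  · intro U _ _ y'
    exact isEmptyElim y'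
  · intro y'
    exact isEmptyElim y'
  · rintro ⟨y', -⟩
    exact isEmptyElim y'

/-- **`ν`-modification at the degenerate maximal value `ν = Φ^{(N)}`** of a reduced locally Noetherian `Y`: the empty modification.
[cite: CossartJannsenSaito2020, Def. 6.14, Lemma 2.23] -/
theorem _root_.Summit.ResolutionOfSingularities.ResolutionOfSingularities.Theorems.SigmaMaxModificationsCorridor3.TameWild.nuMod_of_maximal_Phi
    {Y : Scheme.{0}} [IsLocallyNoetherian Y] [IsReduced Y] {N d : ℕ}
    (hmax : Maximal (· ∈ Scheme.hsValues Y N) (iterPSum N Phi)) : TameWild.NuMod Y N d (iterPSum N Phi) :=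
  TameWild.nuMod_of_forall_mem_hsStratum (forall_mem_hsStratum_of_maximal_Phi hmax)

end Degenerate

/-! ## §4. `HybridEliminationHyp3` and the stub from it -/

/-- Every CLOSED point of the `ν`-stratum of a maximal-origin datum is itself a maximal origin (same global data). [folklore] -/
theorem isMaximalOrigin_of_mem_hsStratum {p N : ℕ} {ν : ℕ → ℕ} {Y : Scheme.{u}} {y y' : Y} (hy : IsMaximalOrigin p N ν Y y)
    (hy' : y' ∈ Scheme.hsStratum Y N ν) (hcl : IsClosed ({y'} : Set Y)) : IsMaximalOrigin p N ν Y y' :=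
  ⟨hy.exists_structure, hy.isReduced, hy.dim_le, hy.maximal, hcl, hy'⟩

/-- [OURS · L1 W4.2] **THE HYBRID ELIMINATION HYPOTHESIS at level `3`, characteristic `p`** (res-L1-w42-plan-1 RULING v3.14-18 (FI): «∃ (π, ω) ⟨clauses⟩ ∧
Low ∧ Iso ∧ Top», with the liveness row NAMED): for every threefold datum — a maximal origin `(Y, y)` of characteristic `p` at level `3`, value
`ν ≠ Φ^{(3)}` — there are a MENU-DISCIPLINED functional policy `π`, a functional fallback stage oracle `ω` and an origin-independent initial boundary `E₀`
such that, for the hybrid `σ = π.hybrid (StrategyE.ofStageOracleE ω)` run from `Y` with boundary `E₀ Y`: the fallback's steps taken from run-reachable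
states have PERMISSIBLE centres inside the `ν`-stratum, non-empty while the stratum is (clause (a)), the fallback ANSWERS on run-reachable states with
non-empty stratum (totality), and at every closed point `y'` of `Y(ν)` the four rows `RowsAtσE σ 3 ν (MarkedStageE.init Y y' (E₀ Y))` hold — (Live) no
eternally-waiting chain, (Low) no moving chain of constant grade `ē ≤ 2`, (Iso) no moving W-top chain isolated infinitely often, (Top) no moving W-top
chain with no isolated stage. The datum-wise `∃` is deliberate (per-datum / per-start policies are legitimate, the conjunct is `∃`-per-`Y`). OURS; NOT a
statement of the manuscript nor of CJS. [cite: CossartJannsenSaito2020, Rem. 6.29 (1), p. 107, Def. 6.14] -/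
def HybridEliminationHyp3 (p : ℕ) : Prop :=
  ∀ (ν : ℕ → ℕ) (Y : Scheme.{0}) [IsLocallyNoetherian Y] (y : Y), IsMaximalOrigin p 3 ν Y y → ν ≠ iterPSum 3 Phi →
    ∃ (π : StrategyE.{0}) (ω : StageOracleE.{0}) (E₀ : ∀ X : Scheme.{0}, Boundary X),
      π.IsMenuDisciplined 3 ν ∧ π.IsFunctional 3 ν ∧ OracleFunctionalΩE ω ∧
      (∀ (W : Scheme.{0}) (hW : IsLocallyNoetherian W) (L : Labelling W) (P : Option (Pending W)) (E : Boundary W),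
        StrategyE.RunReachableState p (π.hybrid (StrategyE.ofStageOracleE ω)) 3 ν (fun X _ => E₀ X) W hW L P E →
        ∀ (C : W.IdealSheafData) (P' : Option (Pending (blowup C))), IsCanonicalStepΩE ω hW 3 ν L E P C P' →
          IdealSheafData.IsPermissible C ∧ (C.support : Set W) ⊆ Scheme.hsStratum W 3 ν ∧
            ((Scheme.hsStratum W 3 ν).Nonempty → (C.support : Set W).Nonempty)) ∧
      (∀ (W : Scheme.{0}) (hW : IsLocallyNoetherian W) (L : Labelling W) (P : Option (Pending W)) (E : Boundary W),
        StrategyE.RunReachableState p (π.hybrid (StrategyE.ofStageOracleE ω)) 3 ν (fun X _ => E₀ X) W hW L P E →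
        (Scheme.hsStratum W 3 ν).Nonempty →
          ∃ (C : W.IdealSheafData) (P' : Option (Pending (blowup C))), IsCanonicalStepΩE ω hW 3 ν L E P C P') ∧
      ∀ y' : Y, y' ∈ Scheme.hsStratum Y 3 ν → IsClosed ({y'} : Set Y) →
        RowsAtσE (π.hybrid (StrategyE.ofStageOracleE ω)) 3 ν (MarkedStageE.init Y y' (E₀ Y))

/-- **(E7) `HybridEliminationHyp3 ⇒ ν-MODIFICATION`** of every threefold maximal-origin datum with `ν ≠ Φ^{(3)}` (inside any dimension class `d ≥ dim Y`):
the E6 socket `nuMod_of_hybrid_ofStageOracleE_noInfiniteNearChain'` (p529895) fed, at every closed `y' ∈ Y(ν)`, by the origin-wise join of the four rows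
(§2) — W-mono for the hybrid's steps from CJS Thm. 3.10 (4) (§1, the hybrid being admissible on its run-wise scope by `hybrid_isAdmissibleOnRunReachable'`).
[cite: CossartJannsenSaito2020, Thm. 3.10 (4), Def. 6.14, Rem. 6.29 (1)] -/
theorem nuMod_of_hybridEliminationHyp3 {p : ℕ} (h310 : CossartJannsenSaito2020_thm_3_10_4.{0}) (H : HybridEliminationHyp3 p)
    {ν : ℕ → ℕ} {Y : Scheme.{0}} [IsLocallyNoetherian Y] {y : Y} (hy : IsMaximalOrigin p 3 ν Y y) (hν : ν ≠ iterPSum 3 Phi)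
    {d : ℕ} (hd : topologicalKrullDim Y ≤ (d : WithBot ℕ∞)) : TameWild.NuMod Y 3 d ν := by
  obtain ⟨π, ω, E₀, hπd, hπf, hω, hτa, hτt, hrows⟩ := H ν Y y hy hν
  have hadm : IsAdmissibleStrategyOnE
      (StrategyE.RunReachableState p (π.hybrid (StrategyE.ofStageOracleE ω)) 3 ν (fun X _ => E₀ X)) 3 ν
      (π.hybrid (StrategyE.ofStageOracleE ω)) :=
    hybrid_isAdmissibleOnRunReachable' hπd hν hτa hτt
  refine nuMod_of_hybrid_ofStageOracleE_noInfiniteNearChain' (E₀ := fun X _ => E₀ X) hπd hπf hω hν hτa hτt hy hd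
    fun y' hy' hcl => ?_
  exact not_exists_chainσE_of_rows
    (fun s s' hs hst => geomDirDim_le_of_canonicalNearStepσE h310 hadm
      ⟨Y, inferInstance, y', isMaximalOrigin_of_mem_hsStratum hy hy' hcl, hs⟩ hst)
    (hrows y' hy' hcl)

/-- **(E7) THE REGISTERED STUB `stub_Wtop_elimination` OF SKELETON v8.3 `w_ladder_elim` (736b6f580a9dcd0c) AT THE PRIME `p`, FROM `HybridEliminationHyp3 p`
AND CJS Thm. 3.10 (4)** — conclusion and hypotheses VERBATIM the stub's body at `p` (the skeleton feeds `h310 := stub_printedFactsL.2.2`): the R-side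
hypothesis «NOT every maximal origin is free of moving never-isolated W-top `R`-chains» is used only to produce a maximal origin of the datum `(Y, ν)`;
at `ν ≠ Φ^{(3)}` the hybrid eliminates `ν` (`nuMod_of_hybridEliminationHyp3`, `d = 3` from `dim Y ≤ 3`), at the degenerate value `ν = Φ^{(3)}` the
empty modification does (§3). [cite: CossartJannsenSaito2020, Thm. 3.10 (4), Def. 6.14, Lemma 2.23, p. 107] -/
theorem wtop_elimination_of_hybridEliminationHyp3 {p : ℕ} (h310 : CossartJannsenSaito2020_thm_3_10_4.{0}) (H : HybridEliminationHyp3 p) :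
    ∀ R : ∀ S : Scheme.{0}, CentreSeq S → Prop, OracleFunctional R → OracleAdmissible R → OracleLocal R →
      (∀ S : Scheme.{0}, CJSScope S → ∃ t, R S t) →
      ∀ (ν : ℕ → ℕ) (Y : Scheme.{0}) [IsLocallyNoetherian Y],
        ¬ (∀ y : Y, IsMaximalOrigin p 3 ν Y y →
            NoMovingNearChainFrom R 3 ν (MarkedStage.init Y y) fun s => 3 ≤ s.geomDirDim ∧ ¬ Iso 3 s) →
        TameWild.NuMod Y 3 3 ν := by
  intro R _ _ _ _ ν Y _ hnot
  obtain ⟨y, hy⟩ : ∃ y : Y, IsMaximalOrigin p 3 ν Y y := by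
    by_contra h
    exact hnot fun y hy => absurd ⟨y, hy⟩ h
  by_cases hν : ν = iterPSum 3 Phi
  · subst hν
    haveI := hy.isReduced
    exact TameWild.nuMod_of_maximal_Phi hy.maximal
  · exact nuMod_of_hybridEliminationHyp3 h310 H hy hν hy.dim_le

/-! ## §5. How the GLOBAL rows of record feed the origin-wise conjuncts -/

section Plug

variable {σ : StrategyE.{u}} {p : ℕ} {Q : ℕ → (ℕ → ℕ) → ∀ X : Scheme.{u}, X → Prop} {E₀ : ∀ X : Scheme.{u}, Boundary X}

/-- **GLOBAL ROWS ⇒ THE FOUR ROWS AT A CLOSED POINT OF THE STRATUM**: at a closed `y' ∈ Y(ν)` of a maximal-origin datum lying in the origin class `Q`,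
the liveness row at `Q`-origins, the constant-low-grade moving rows `MaxOriginNoMovingNearChainAtQσE σ p 3 Q E₀' (ē = e)` (`e ≤ 2`), res-type-012's
`WtopRecIsoMσE σ p Q E₀'` and the Ev-NonIso row `WtopEvNonIsoMσE σ p Q E₀'` — all with the origin-independent boundary `E₀' = fun X _ => E₀ X` — give
`RowsAtσE σ 3 ν (MarkedStageE.init Y y' (E₀ Y))` (every closed point of the stratum is a maximal origin). [folklore] -/
theorem rowsAtσE_of_globalRows {ν : ℕ → ℕ} {Y : Scheme.{u}} [IsLocallyNoetherian Y] {y y' : Y} (hy : IsMaximalOrigin p 3 ν Y y)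
    (hy' : y' ∈ Scheme.hsStratum Y 3 ν) (hcl : IsClosed ({y'} : Set Y)) (hQ : Q 3 ν Y y')
    (hlive : ∀ (μ : ℕ → ℕ) (X : Scheme.{u}) [IsLocallyNoetherian X] (x : X), IsMaximalOrigin p 3 μ X x → Q 3 μ X x →
      NoWaitingChainFromσE σ 3 μ (MarkedStageE.init X x (E₀ X)))
    (hlow : ∀ e, e ≤ 2 → MaxOriginNoMovingNearChainAtQσE σ p 3 Q (fun X _ => E₀ X) fun s => s.geomDirDim = e)
    (hiso : WtopRecIsoMσE σ p Q fun X _ => E₀ X) (htop : WtopEvNonIsoMσE σ p Q fun X _ => E₀ X) :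
    RowsAtσE σ 3 ν (MarkedStageE.init Y y' (E₀ Y)) := by
  have hy'' : IsMaximalOrigin p 3 ν Y y' := isMaximalOrigin_of_mem_hsStratum hy hy' hcl
  exact ⟨hlive ν Y y' hy'' hQ, fun e he => hlow e (by omega) ν Y y' hy'' hQ, hiso ν Y y' hy'' hQ, htop ν Y y' hy'' hQ⟩

/-- **… for the class of ALL origins** (`Q = ⊤`). [folklore] -/
theorem rowsAtσE_of_globalRows_all {ν : ℕ → ℕ} {Y : Scheme.{u}} [IsLocallyNoetherian Y] {y y' : Y} (hy : IsMaximalOrigin p 3 ν Y y)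
    (hy' : y' ∈ Scheme.hsStratum Y 3 ν) (hcl : IsClosed ({y'} : Set Y))
    (hlive : ∀ (μ : ℕ → ℕ) (X : Scheme.{u}) [IsLocallyNoetherian X] (x : X), IsMaximalOrigin p 3 μ X x →
      NoWaitingChainFromσE σ 3 μ (MarkedStageE.init X x (E₀ X)))
    (hlow : ∀ e, e ≤ 2 → MaxOriginNoMovingNearChainAtQσE σ p 3 (fun _ _ _ _ => True) (fun X _ => E₀ X) fun s => s.geomDirDim = e)
    (hiso : WtopRecIsoMσE σ p (fun _ _ _ _ => True) fun X _ => E₀ X)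
    (htop : WtopEvNonIsoMσE σ p (fun _ _ _ _ => True) fun X _ => E₀ X) :
    RowsAtσE σ 3 ν (MarkedStageE.init Y y' (E₀ Y)) :=
  rowsAtσE_of_globalRows (Q := fun _ _ _ _ => True) hy hy' hcl trivial (fun μ X _ x hx _ => hlive μ X x hx) hlow hiso htop

end Plug

end Summit.ResolutionOfSingularities.ResolutionOfSingularities.Theorems.SigmaMaxModificationsCorridor3.Sigma

end
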